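import Summits.BirchSwinnertonDyer.Rank1Residual.X11b.ClassClosureWeightKChain
import Summits.BirchSwinnertonDyer.Rank1Residual.X11b.RegMultCongruenceTransport
import HarnessLib

/-!
# Class X11b = N8/O2 (lane CLASS-CLOSURE, seat `cc-typer-3`, target T-WK (b)–(c)): the weight-`k`
# chain FED TO THE LEVER — `BSD(E,p)` on X11b at `p ≥ 5` with `ρ̄_{E,p}` onto from named published
# facts + the per-pair certificates `μ^an(E,p) = 0` and REG-MULT (+ Disegni's (∗) or the exceptional
# conjecture at a split `p`); no (ram), no analytic-rank-zero (cell `b2b-bsdres`)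

HONEST FRAMING (verbatim, cell `b2b-bsdres`, run/shared/lean/b2b/bsd-rank1-residual/): the goal of
the cell is to DELETE the COMBINATION-SHAPED residual classes for ALL analytic-rank `≤ 1` curves
over `ℚ` — "full BSD formula for every rank `≤ 1` curve in class `C`" assembled STRICTLY from
published theorems — so that the rank-`≤ 1` remainder becomes exactly the CONSTRUCTION-SHAPED
classes, which are TYPED (missing-input Props), NOT attempted; this is not "finishing BSD".
Lane CLASS-CLOSURE (coordinator ruling 2026-08-21T04:07Z): prove what is provable now; shrink each
hard class to its core with data; no claim beyond stated classes. THEOREMS ONLY (no definition, no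
named fact, no `sorry`); nothing booked; no label / RESIDUAL-MAP mark changes; X11b stays
CONSTRUCTION-SHAPED; every theorem is CONDITIONAL on the named published facts and per-pair inputs
it lists; census / instrument rows (a unit coefficient of `ϖ·L_p`, a REGMULT height, the bit "second
multiplicative prime") are EVIDENCE / instrumentation — their worth is referee A's / the lane's
ruling; the class-wide statements behind them are Greenberg's `μ`-conjecture and Schneider's
conjecture (barrier `PAdicHeightNondegeneracy`), NEVER asserted here.

## What this file does (cc-lead GEN 7 TARGET T-WK (b), (c); GEN 8 note "T-WK (b) = (a) ∘ p254516")

`X11b/ClassClosureWeightKChain.lean` (T-WK (a)) gives `X2.MazurMainConjectureAt W p` RANK-FREE at a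
multiplicative `p ≥ 5` with `ρ̄_{E,p}` onto from x11a's named facts + `MuAnZeroAt W p`
(`mazurMainConjectureAt_of_namedFacts_bdd`). This file composes it with the analytic-rank-ONE lever:
* §1 `bsdp_of_mazurMainConjectureAt_of_split_of_conjecture_of_schneider` /
  `bsdp_of_mazurMainConjectureAt_of_regulatorNonvanishing_of_conjecture` — the lever fed by Mazur's
  main conjecture with, at a SPLIT `p`, the lane's EVIDENCE-labelled conjecture
  `RelativeExceptionalLeadingTermAt W p` (Disegni's split display WITHOUT (∗); `@[conjecture]`,
  `X11b/ClassClosureTyped.lean`; a THEOREM when `p ≥ 5` and a second multiplicative prime exists,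
  `relativeExceptionalLeadingTermAt_of_disegni_of_five_le`) in place of Disegni's theorem — the
  `X2.MazurMainConjectureAt`-fed twins of `bsdp_three_of_splitThreeResidue_of_conjecture`;
* §2 T-WK (b): `bsdp_of_namedFacts_bdd_of_regulatorNonvanishing` — on `ClassX11b W p`, `5 ≤ p`,
  `Surj W p`: `BSD(E,p)` from the named facts + `MuAnZeroAt W p` + `RegulatorNonvanishingAt W p` +
  (split `p`) a second multiplicative prime (= (a) ∘ p252284); `bsdp_of_namedFacts_bdd_of_cert`
  (= (a) ∘ p254516, ONE REGMULT row of the sign's kind); `bsdp_of_unitCoeffAt_of_cert` (TWO finite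
  certificates: iw-1's `UnitCoeffAt W p n` + one REGMULT row); `…_of_regulatorNonvanishing_of_conjecture`
  (the exceptional twin for split cells with `p` the only multiplicative prime);
* §3 T-WK (c): `forall_bsdp_of_namedFacts_bdd_of_regulatorNonvanishing` / `…_of_cert` — the
  rank-ONE twins of `X11a.forall_bsdp_of_namedFacts_bdd`.
CONSEQUENCE (a reading; no count moved, nothing booked): N8's `¬Ram ∧ surj` cells at `p ≥ 5` (137 of
the 138 `¬Ram` cells in rmap-3 g7's table: 81 très ramifié + 7 partner-less + 49 transport) sit on
PUBLISHED named facts + TWO finite per-pair certificates — `μ^an(E,p) = 0` (instrument B-5, universe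
extended to these cells by the T-WK ruling) and REG-MULT C6 (138/138 CERT, W5 kit j123725,
census-ctyper-2 `regmult/INSTANCES-t0-C6`) — plus C5 at a split `p` (or the conjecture); on (ram)
cells Skinner's Thm. A already feeds the lever without `μ` (`X11b/ClassClosureTyped.lean`). Flags
riding along on the facts used (informational, referee A's standing N7 reading):
`Wan15-Thm103-Fujiwara`, `Wan15-BCS25-Rem113ii`, `EPW-canonical-period`, `MTT86-primary-image-only`,
`Wu14-surj-attribution`, `Dis20-height-identification-reading`. Tier / label: referee A + x11b3 lead.

References: [EmertonPollackWeston2006] Thm. 1, 3.1.1, 5.1.3; [Wan2015] Thm. 4; [Wuthrich2014] Thm.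
3, Cor. 19; [Skinner2016PacificMC] §3.2–3.3 (shape); [SteinWuthrich2013] Thm. 6.1, §4.2;
[Disegni2020] Thm. 1, (∗); [Miller2011LMS] Def. 1.1; [Schneider1982] §1;
HOME/class-closure/O2/TYPER-3.md §9 (GEN 3).
-/

set_option autoImplicit false

noncomputable section

open scoped Classical MatrixGroups ModularForm

open CongruenceSubgroup WeierstrassCurve Literature.NumberTheory.EllipticCurves
  Literature.NumberTheory.EllipticCurves.ModularForms
  Literature.NumberTheory.EllipticCurves.Rank1Residual
  Literature.NumberTheory.EllipticCurves.Rank1Residual.Typed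
  Literature.NumberTheory.EllipticCurves.Skinner2016
  Literature.NumberTheory.EllipticCurves.SteinWuthrich2013
  Literature.NumberTheory.EllipticCurves.Wuthrich2014
  Literature.NumberTheory.EllipticCurves.Disegni2020
  Literature.NumberTheory.EllipticCurves.GreenbergVatsal2000
  Literature.NumberTheory.EllipticCurves.EmertonPollackWeston2006
  Summit.BirchSwinnertonDyer.Rank1Residual.X1.MuLambda

namespace Summit.BirchSwinnertonDyer.Rank1Residual.X11b.ClassClosure

open X11a X11a.Chain

/-! ### §1 The lever fed by Mazur's main conjecture, split clause through the conjecture -/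

section Lever

variable (W : WeierstrassCurve ℚ) [W.IsElliptic] [W.IsGloballyMinimal] (p : ℕ) [Fact p.Prime]

/-- **X11b, SPLIT at the odd prime `p`, `p` possibly the ONLY multiplicative prime: `BSD(E,p)` from
Mazur's main conjecture at the pair (`hMC`), Stein–Wuthrich Thm. 6.1 split (`hJ`), the modified
§4.2 height (`hH`), GZK, modularity, the lane's EVIDENCE-labelled CONJECTURE
`RelativeExceptionalLeadingTermAt W p` in place of Disegni's theorem, and the split Schneider half.**
The `X2.MazurMainConjectureAt`-fed twin of `bsdp_three_of_splitThreeResidue_of_conjecture` (there the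
main conjecture is Skinner's Thm. A on (ram)); no (ram), no `μ`, no second multiplicative prime, no
`p ≥ 5`; `𝓛_p ≠ 0` is a tree theorem. CONDITIONAL on an UNPROVED conjecture; nothing booked.
[cite: Skinner2016PacificMC, Thm. A (§1) with §3.2–3.3 (shape only)] [cite: SteinWuthrich2013, Thm. 6.1 (p. 20) and §4.2]
[cite: Disegni2020, Thm. 1 (§1.2) with hypothesis (∗) removed (shape only; nothing asserted)]
[cite: Miller2011LMS, Def. 1.1] -/
theorem bsdp_of_mazurMainConjectureAt_of_split_of_conjecture_of_schneider
    (hJ : thm61_splitMultiplicative) (hH : exists_isSplitMultCanonical)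
    (hGZK : rank_eq_analyticRank_of_analyticRank_le_one) (hpar : nonempty_modularParametrizationData)
    (hX : ClassX11b W p) (hsplit : W.HasSplitMultiplicativeReductionAtPrime p)
    (hMC : X2.MazurMainConjectureAt W p) (hC : RelativeExceptionalLeadingTermAt W p)
    (hSch : ∀ (Dq : TateParameterData W p) (Dh : PAdicHeightData W p),
      IsSplitMultCanonical Dh Dq → SchneiderConjecture Dh) :
    BSDp W p := by
  obtain ⟨hr, hp2, -, -⟩ := hX
  obtain ⟨κ, hκ, γ, hγ, hγ'⟩ := exists_isCyclotomic_isTopGenerator_isCyclotomicVariable_holds p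
  obtain ⟨D⟩ := W.nonempty_selmerDualData_holds κ γ hγ
  haveI : NeZero (W.conductorNorm ℤ) := ⟨(W.conductorNorm_pos_holds).ne'⟩
  obtain ⟨Dm⟩ := hpar W
  obtain ⟨ϖ, hϖpos, hϖ, -⟩ := Dm.exists_rat_mul_realPeriodRat_eq_plusPeriod
  obtain ⟨L, hL⟩ := exists_isSplitMultPAdicLFunctionOf hsplit Dm.isNewformOf
  obtain ⟨Dq⟩ := (nonempty_tateParameterData_iff_holds (W := W) (p := p)).mpr hsplit
  obtain ⟨Dh, hDh⟩ := hH W p hp2 Dq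
  -- Mazur's statement for this data (split clause)
  obtain ⟨hXt, g, hchar, hsp, -⟩ := hMC κ γ hκ hγ hγ' _ Dm.isNewformOf D ϖ hϖ
  obtain ⟨w, hw⟩ := hsp hsplit L hL
  -- the relative exceptional display AT THE PAIR, from the conjecture
  obtain ⟨s, u', hs, hDis⟩ := hC hp2 hsplit hr Dm.isNewformOf ϖ hϖpos.ne' hϖ Dq L hL Dh hDh
  exact bsdp_of_split_of_relativeLeadingTerm_of_schneider W p hJ hGZK hp2 hr Dq hκ hγ hγ' D hXt hchar
    w hw Dh hDh hs u' hDis (hSch Dq Dh hDh)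

/-- **X11b at `p`, BOTH reduction signs, the split clause through the conjecture**: `BSD(E,p)` from
`X2.MazurMainConjectureAt W p`, the published facts (Stein–Wuthrich Thm. 6.1 ×2, §4.2 ×2, Disegni
2020 Thm. 1 non-split clause `hD`, GZK, modularity), the per-pair `RegulatorNonvanishingAt W p` and —
ONLY if `E` is split at `p` — the conjecture `RelativeExceptionalLeadingTermAt W p`. No (ram), no `μ`.
CONDITIONAL; nothing booked. [cite: Skinner2016PacificMC, Thm. A (§1) with §3.2–3.3 (shape only)]
[cite: SteinWuthrich2013, Thm. 6.1, §4.2] [cite: Disegni2020, Thm. 1 (§1.2)] [cite: Miller2011LMS, Def. 1.1] -/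
theorem bsdp_of_mazurMainConjectureAt_of_regulatorNonvanishing_of_conjecture
    (hJn : thm61_nonsplitMultiplicative) (hJs : thm61_splitMultiplicative)
    (hHn : exists_isMultCanonical) (hHs : exists_isSplitMultCanonical)
    (hD : thm1_padicBSD_rankOne_multiplicative)
    (hGZK : rank_eq_analyticRank_of_analyticRank_le_one) (hpar : nonempty_modularParametrizationData)
    (hX : ClassX11b W p) (hMC : X2.MazurMainConjectureAt W p) (hReg : RegulatorNonvanishingAt W p)
    (hC : W.HasSplitMultiplicativeReductionAtPrime p → RelativeExceptionalLeadingTermAt W p) :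
    BSDp W p := by
  by_cases hsplit : W.HasSplitMultiplicativeReductionAtPrime p
  · exact bsdp_of_mazurMainConjectureAt_of_split_of_conjecture_of_schneider W p hJs hHs hGZK hpar hX
      hsplit hMC (hC hsplit) hReg.2
  · exact bsdp_of_mazurMainConjectureAt_of_nonsplit_of_schneider W p hJn hHn hGZK hpar
      (fun hf ϖ hϖ0 hϖ q hq0 hq1 hqj L hL Dh hDh =>
        thm1_padicBSD_rankOne_multiplicative.nonsplit hD W p hX.2.1 hX.2.2.1 hX.1 hf ϖ hϖ0 hϖ hsplit
          hq0 hq1 hqj L hL Dh hDh)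
      hX hsplit hMC hReg.1

end Lever

/-! ### §2 T-WK (b): X11b at `p ≥ 5`, `ρ̄_{E,p}` onto — the chain fed to the lever -/

section PairLevel

variable (W : WeierstrassCurve ℚ) [W.IsElliptic] [W.IsGloballyMinimal] (p : ℕ) [Fact p.Prime]

/-- **T-WK (b) — X11b, `p ≥ 5`, `ρ̄_{E,p}` onto: `BSD(E,p)` from NAMED PUBLISHED FACTS — x11a's
(Hida member `hHida`, MTT weight `k` `hMTT`, EPW Thm. 3.1.1 `h311` / Thm. 1 `hT1a` / Thm. 5.1.3 bounded
`hT1b`, Wan Thm. 4 rational bounded `hT2`, Deligne–Serre 6.1 `h61`, Hida 3.26 `h326`, Kato–Wuthrich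
A32 `hKato`) and the lever's (Stein–Wuthrich Thm. 6.1 ×2 `hJn hJs` + §4.2 ×2 `hHn hHs`, Disegni 2020
Thm. 1 `hD`, GZK `hGZK`, modularity `hpar`) — and THREE per-pair inputs: the certificate
`MuAnZeroAt W p` (`μ^an(E,p) = 0`, instrument B-5), `RegulatorNonvanishingAt W p` (REG-MULT C6), and
at a SPLIT `p` a second multiplicative prime (`hm`: Disegni's (∗), census bit C5).** = T-WK (a)
`mazurMainConjectureAt_of_namedFacts_bdd` ∘ p252284 `bsdp_of_mazurMainConjectureAt_of_regulatorNonvanishing`.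
NO (ram), NO analytic-rank-zero, NO `#Ш_an` / Tamagawa / anomalous / partner hypothesis; class-level
residues: Greenberg's `μ`-conjecture and Schneider's conjecture (OPEN, NAMED, typed). CONDITIONAL;
nothing booked; X11b stays CONSTRUCTION-SHAPED. [cite: EmertonPollackWeston2006, Thm. 1, Thm. 3.1.1, Thm. 5.1.3, §3.1]
[cite: Wan2015, Thm. 4] [cite: Wuthrich2014, Thm. 3 (p. 382) and Cor. 19 proof (p. 399)]
[cite: SteinWuthrich2013, Thm. 6.1 (p. 20), §4.2] [cite: Disegni2020, Thm. 1 (§1.2), hypothesis (∗)]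
[cite: Miller2011LMS, Def. 1.1] -/
theorem bsdp_of_namedFacts_bdd_of_regulatorNonvanishing
    (hHida : hida_exists_congruent_ordinary_newform_of_multiplicative)
    (hMTT : exists_isCycPAdicLFunctionWeightK)
    (h311 : thm311_cotorsion_weightK_member) (hT1a : thm1_muAlg_of_weightK_member)
    (hT2 : Wan2015.thm4_rational_weightK_member_of_bdd)
    (hT1b : thm513_transfer_from_weightK_member_of_bdd)
    (h61 : DeligneSerre1974.thm61_exists_adicGaloisRep) (h326 : Hida2000_thm326_ordinary)
    (hKato : kato_charIdeal_dvd_multiplicative_of_surjective)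
    (hJn : thm61_nonsplitMultiplicative) (hJs : thm61_splitMultiplicative)
    (hHn : exists_isMultCanonical) (hHs : exists_isSplitMultCanonical)
    (hD : thm1_padicBSD_rankOne_multiplicative)
    (hGZK : rank_eq_analyticRank_of_analyticRank_le_one) (hpar : nonempty_modularParametrizationData)
    (hX : ClassX11b W p) (hp : 5 ≤ p) (hsurj : Surj W p) (hμ : MuAnZeroAt W p)
    (hm : W.HasSplitMultiplicativeReductionAtPrime p →
      ∃ (m : ℕ) (_ : Fact m.Prime), m ≠ p ∧ W.HasMultiplicativeReductionAtPrime m)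
    (hReg : RegulatorNonvanishingAt W p) : BSDp W p :=
  bsdp_of_mazurMainConjectureAt_of_regulatorNonvanishing W p hJn hJs hHn hHs hD hGZK hpar hX
    (fun hs => ⟨hp, hm hs⟩)
    (mazurMainConjectureAt_of_namedFacts_bdd W p hHida hMTT h311 hT1a hT2 hT1b h61 h326 hKato hpar hp
      hX.2.2.1 hsurj hμ)
    hReg

/-- **T-WK (b), exceptional twin**: as `bsdp_of_namedFacts_bdd_of_regulatorNonvanishing` with
Disegni's (∗) at a split `p` replaced by the conjecture `RelativeExceptionalLeadingTermAt W p`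
(demanded ONLY if `E` is split at `p`) — the road for the split `¬Ram` cells with `p` the only
multiplicative prime (multr1-p2's (T2∗) residue, `X11b/BDPRouteCyclotomicExceptional.lean`).
CONDITIONAL on an unproved conjecture where used; nothing booked.
[cite: EmertonPollackWeston2006, Thm. 1, Thm. 3.1.1, Thm. 5.1.3] [cite: Wan2015, Thm. 4]
[cite: SteinWuthrich2013, Thm. 6.1, §4.2] [cite: Disegni2020, Thm. 1 (§1.2)] [cite: Miller2011LMS, Def. 1.1] -/
theorem bsdp_of_namedFacts_bdd_of_regulatorNonvanishing_of_conjecture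
    (hHida : hida_exists_congruent_ordinary_newform_of_multiplicative)
    (hMTT : exists_isCycPAdicLFunctionWeightK)
    (h311 : thm311_cotorsion_weightK_member) (hT1a : thm1_muAlg_of_weightK_member)
    (hT2 : Wan2015.thm4_rational_weightK_member_of_bdd)
    (hT1b : thm513_transfer_from_weightK_member_of_bdd)
    (h61 : DeligneSerre1974.thm61_exists_adicGaloisRep) (h326 : Hida2000_thm326_ordinary)
    (hKato : kato_charIdeal_dvd_multiplicative_of_surjective)
    (hJn : thm61_nonsplitMultiplicative) (hJs : thm61_splitMultiplicative)
    (hHn : exists_isMultCanonical) (hHs : exists_isSplitMultCanonical)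
    (hD : thm1_padicBSD_rankOne_multiplicative)
    (hGZK : rank_eq_analyticRank_of_analyticRank_le_one) (hpar : nonempty_modularParametrizationData)
    (hX : ClassX11b W p) (hp : 5 ≤ p) (hsurj : Surj W p) (hμ : MuAnZeroAt W p)
    (hReg : RegulatorNonvanishingAt W p)
    (hC : W.HasSplitMultiplicativeReductionAtPrime p → RelativeExceptionalLeadingTermAt W p) :
    BSDp W p :=
  bsdp_of_mazurMainConjectureAt_of_regulatorNonvanishing_of_conjecture W p hJn hJs hHn hHs hD hGZK hpar
    hX
    (mazurMainConjectureAt_of_namedFacts_bdd W p hHida hMTT h311 hT1a hT2 hT1b h61 h326 hKato hpar hp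
      hX.2.2.1 hsurj hμ)
    hReg hC

/-- **T-WK (b) with ONE REGMULT row of the reduction sign's kind** (census-ctyper-2's sign-aware C6:
`RegMult.CertSplit` iff split — then C5 `hm` is due —, `RegMult.CertNonsplit` iff non-split):
T-WK (a) `mazurMainConjectureAt_of_namedFacts_bdd` ∘ p254516 `RegMult.bsdp_of_mazurMainConjectureAt_of_cert`.
CONDITIONAL; nothing booked; the row is instrumentation.
[cite: EmertonPollackWeston2006, Thm. 1, Thm. 3.1.1, Thm. 5.1.3] [cite: Wan2015, Thm. 4]
[cite: SteinWuthrich2013, Thm. 6.1, §4.2] [cite: Disegni2020, Thm. 1 (§1.2), hypothesis (∗)]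
[cite: Miller2011LMS, Def. 1.1] [cite: Schneider1982PadicHeightI, §1] -/
theorem bsdp_of_namedFacts_bdd_of_cert
    (hHida : hida_exists_congruent_ordinary_newform_of_multiplicative)
    (hMTT : exists_isCycPAdicLFunctionWeightK)
    (h311 : thm311_cotorsion_weightK_member) (hT1a : thm1_muAlg_of_weightK_member)
    (hT2 : Wan2015.thm4_rational_weightK_member_of_bdd)
    (hT1b : thm513_transfer_from_weightK_member_of_bdd)
    (h61 : DeligneSerre1974.thm61_exists_adicGaloisRep) (h326 : Hida2000_thm326_ordinary)
    (hKato : kato_charIdeal_dvd_multiplicative_of_surjective)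
    (hJn : thm61_nonsplitMultiplicative) (hJs : thm61_splitMultiplicative)
    (hHn : exists_isMultCanonical) (hHs : exists_isSplitMultCanonical)
    (hD : thm1_padicBSD_rankOne_multiplicative)
    (hGZK : rank_eq_analyticRank_of_analyticRank_le_one) (hpar : nonempty_modularParametrizationData)
    (hX : ClassX11b W p) (hp : 5 ≤ p) (hsurj : Surj W p) (hμ : MuAnZeroAt W p)
    (hm : W.HasSplitMultiplicativeReductionAtPrime p →
      ∃ (m : ℕ) (_ : Fact m.Prime), m ≠ p ∧ W.HasMultiplicativeReductionAtPrime m)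
    {P : W.toAffine.Point} {m : ℕ}
    (hcn : ¬ W.HasSplitMultiplicativeReductionAtPrime p → RegMult.CertNonsplit W p P m)
    (hcs : W.HasSplitMultiplicativeReductionAtPrime p → RegMult.CertSplit W p P m) : BSDp W p :=
  RegMult.bsdp_of_mazurMainConjectureAt_of_cert W p hJn hJs hHn hHs hD hGZK hpar hX
    (fun hs => ⟨hp, hm hs⟩)
    (mazurMainConjectureAt_of_namedFacts_bdd W p hHida hMTT h311 hT1a hT2 hT1b h61 h326 hKato hpar hp
      hX.2.2.1 hsurj hμ)
    hcn hcs

/-- **TWO FINITE CERTIFICATES PER PAIR**: on X11b at `p ≥ 5` with `ρ̄_{E,p}` onto, `BSD(E,p)` from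
the named published facts + ONE unit coefficient of `ϖ·L_p` (iw-1's `Iwasawa.UnitCoeffAt W p n`,
two-engine census row; `Iwasawa.muAnZeroAt_of_unitCoeffAt`) + ONE REGMULT row of the sign's kind
(+ C5 at a split `p`). The kernel form of the T-WK ruling's CONSEQUENCE sentence for N8's
`¬Ram ∧ surj` cells — a reading, no count moved; CONDITIONAL; nothing booked.
[cite: GreenbergVatsal2000, p. 2–3, (2)] [cite: EmertonPollackWeston2006, Thm. 1, Thm. 5.1.3]
[cite: Wan2015, Thm. 4] [cite: SteinWuthrich2013, Thm. 6.1, §4.2] [cite: Disegni2020, Thm. 1 (§1.2), hypothesis (∗)]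
[cite: Miller2011LMS, Def. 1.1] -/
theorem bsdp_of_unitCoeffAt_of_cert
    (hHida : hida_exists_congruent_ordinary_newform_of_multiplicative)
    (hMTT : exists_isCycPAdicLFunctionWeightK)
    (h311 : thm311_cotorsion_weightK_member) (hT1a : thm1_muAlg_of_weightK_member)
    (hT2 : Wan2015.thm4_rational_weightK_member_of_bdd)
    (hT1b : thm513_transfer_from_weightK_member_of_bdd)
    (h61 : DeligneSerre1974.thm61_exists_adicGaloisRep) (h326 : Hida2000_thm326_ordinary)
    (hKato : kato_charIdeal_dvd_multiplicative_of_surjective)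
    (hJn : thm61_nonsplitMultiplicative) (hJs : thm61_splitMultiplicative)
    (hHn : exists_isMultCanonical) (hHs : exists_isSplitMultCanonical)
    (hD : thm1_padicBSD_rankOne_multiplicative)
    (hGZK : rank_eq_analyticRank_of_analyticRank_le_one) (hpar : nonempty_modularParametrizationData)
    (hX : ClassX11b W p) (hp : 5 ≤ p) (hsurj : Surj W p) {n : ℕ} (hcertμ : Iwasawa.UnitCoeffAt W p n)
    (hm : W.HasSplitMultiplicativeReductionAtPrime p →
      ∃ (m : ℕ) (_ : Fact m.Prime), m ≠ p ∧ W.HasMultiplicativeReductionAtPrime m)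
    {P : W.toAffine.Point} {m : ℕ}
    (hcn : ¬ W.HasSplitMultiplicativeReductionAtPrime p → RegMult.CertNonsplit W p P m)
    (hcs : W.HasSplitMultiplicativeReductionAtPrime p → RegMult.CertSplit W p P m) : BSDp W p :=
  bsdp_of_namedFacts_bdd_of_cert W p hHida hMTT h311 hT1a hT2 hT1b h61 h326 hKato hJn hJs hHn hHs hD
    hGZK hpar hX hp hsurj (Iwasawa.muAnZeroAt_of_unitCoeffAt hcertμ) hm hcn hcs

end PairLevel

/-! ### §3 T-WK (c): class level -/

/-- **T-WK (c) — X11b ∩ {`p ≥ 5`, `ρ̄_{E,p}` onto}: `BSD(E,p)` ⇐ NAMED PUBLISHED FACTS + the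
per-pair certificate `μ^an(E,p) = 0` + the per-pair regulator input + (split `p`) a second
multiplicative prime — no displayed hypothesis; the analytic-rank-ONE twin of
`X11a.forall_bsdp_of_namedFacts_bdd`.** In words: on N8's surjective-image cells at `p ≥ 5` — (ram)
or not, peu or très ramifié — the `p`-part of BSD in analytic rank one follows from the published
record (Hida member; Mazur–Tate–Teitelbaum; EPW Thm 3.1.1 / Thm 1 / Thm 5.1.3 bounded; Wan Thm 4
rational bounded; Deligne–Serre 6.1; Hida 3.26; Kato–Wuthrich A32; Stein–Wuthrich Thm 6.1 ×2 + §4.2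
×2; Disegni 2020 Thm 1; GZK; modularity) plus finite per-pair certificates (`μ^an = 0`; a non-zero
canonical `p`-adic height; the census bit "second multiplicative prime" at a split `p`), the
class-level residues being Greenberg's `μ`-conjecture and Schneider's conjecture (OPEN, NAMED, typed).
No label change (referee A / x11b3 lead). CONDITIONAL; nothing booked; X11b stays CONSTRUCTION-SHAPED.
[cite: EmertonPollackWeston2006, Thm. 1, Thm. 3.1.1, Thm. 5.1.3, §3.1] [cite: Wan2015, Thm. 4]
[cite: Wuthrich2014, Thm. 3 (p. 382) and Cor. 19 proof (p. 399)] [cite: SteinWuthrich2013, Thm. 6.1 (p. 20), §4.2]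
[cite: Disegni2020, Thm. 1 (§1.2), hypothesis (∗)] [cite: Miller2011LMS, Def. 1.1] -/
theorem forall_bsdp_of_namedFacts_bdd_of_regulatorNonvanishing
    (hHida : hida_exists_congruent_ordinary_newform_of_multiplicative)
    (hMTT : exists_isCycPAdicLFunctionWeightK)
    (h311 : thm311_cotorsion_weightK_member) (hT1a : thm1_muAlg_of_weightK_member)
    (hT2 : Wan2015.thm4_rational_weightK_member_of_bdd)
    (hT1b : thm513_transfer_from_weightK_member_of_bdd)
    (h61 : DeligneSerre1974.thm61_exists_adicGaloisRep) (h326 : Hida2000_thm326_ordinary)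
    (hKato : kato_charIdeal_dvd_multiplicative_of_surjective)
    (hJn : thm61_nonsplitMultiplicative) (hJs : thm61_splitMultiplicative)
    (hHn : exists_isMultCanonical) (hHs : exists_isSplitMultCanonical)
    (hD : thm1_padicBSD_rankOne_multiplicative)
    (hGZK : rank_eq_analyticRank_of_analyticRank_le_one) (hpar : nonempty_modularParametrizationData) :
    ∀ (W : WeierstrassCurve ℚ) [W.IsElliptic] [W.IsGloballyMinimal] (p : ℕ) [Fact p.Prime],
      ClassX11b W p → 5 ≤ p → Surj W p → MuAnZeroAt W p →
      (W.HasSplitMultiplicativeReductionAtPrime p →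
        ∃ (m : ℕ) (_ : Fact m.Prime), m ≠ p ∧ W.HasMultiplicativeReductionAtPrime m) →
      RegulatorNonvanishingAt W p → BSDp W p :=
  fun W _ _ p _ hX hp hsurj hμ hm hReg =>
    bsdp_of_namedFacts_bdd_of_regulatorNonvanishing W p hHida hMTT h311 hT1a hT2 hT1b h61 h326 hKato hJn
      hJs hHn hHs hD hGZK hpar hX hp hsurj hμ hm hReg

/-- **T-WK (c), REGMULT-row form**: as `forall_bsdp_of_namedFacts_bdd_of_regulatorNonvanishing` with
the regulator input supplied by ONE REGMULT row of the reduction sign's kind. CONDITIONAL; nothing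
booked; rows are instrumentation. [cite: EmertonPollackWeston2006, Thm. 1, Thm. 3.1.1, Thm. 5.1.3, §3.1]
[cite: Wan2015, Thm. 4] [cite: SteinWuthrich2013, Thm. 6.1, §4.2] [cite: Disegni2020, Thm. 1 (§1.2), hypothesis (∗)]
[cite: Miller2011LMS, Def. 1.1] -/
theorem forall_bsdp_of_namedFacts_bdd_of_cert
    (hHida : hida_exists_congruent_ordinary_newform_of_multiplicative)
    (hMTT : exists_isCycPAdicLFunctionWeightK)
    (h311 : thm311_cotorsion_weightK_member) (hT1a : thm1_muAlg_of_weightK_member)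
    (hT2 : Wan2015.thm4_rational_weightK_member_of_bdd)
    (hT1b : thm513_transfer_from_weightK_member_of_bdd)
    (h61 : DeligneSerre1974.thm61_exists_adicGaloisRep) (h326 : Hida2000_thm326_ordinary)
    (hKato : kato_charIdeal_dvd_multiplicative_of_surjective)
    (hJn : thm61_nonsplitMultiplicative) (hJs : thm61_splitMultiplicative)
    (hHn : exists_isMultCanonical) (hHs : exists_isSplitMultCanonical)
    (hD : thm1_padicBSD_rankOne_multiplicative)
    (hGZK : rank_eq_analyticRank_of_analyticRank_le_one) (hpar : nonempty_modularParametrizationData) :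
    ∀ (W : WeierstrassCurve ℚ) [W.IsElliptic] [W.IsGloballyMinimal] (p : ℕ) [Fact p.Prime],
      ClassX11b W p → 5 ≤ p → Surj W p → MuAnZeroAt W p →
      (W.HasSplitMultiplicativeReductionAtPrime p →
        ∃ (m : ℕ) (_ : Fact m.Prime), m ≠ p ∧ W.HasMultiplicativeReductionAtPrime m) →
      ∀ {P : W.toAffine.Point} {m : ℕ},
        (¬ W.HasSplitMultiplicativeReductionAtPrime p → RegMult.CertNonsplit W p P m) →
        (W.HasSplitMultiplicativeReductionAtPrime p → RegMult.CertSplit W p P m) → BSDp W p :=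
  fun W _ _ p _ hX hp hsurj hμ hm _ _ hcn hcs =>
    bsdp_of_namedFacts_bdd_of_cert W p hHida hMTT h311 hT1a hT2 hT1b h61 h326 hKato hJn hJs hHn hHs hD
      hGZK hpar hX hp hsurj hμ hm hcn hcs

end Summit.BirchSwinnertonDyer.Rank1Residual.X11b.ClassClosure

end
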